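import Literature.Geometry.Lorentzian.KerrSchildSymmHypReduction
import Literature.Analysis.PDE.SymmetricHyperbolicDerived
import HarnessLib

/-!
# Symmetric smooth coefficients on `ℝ × ℝ³` which are constant far out are regular admissible
# coefficients of Friedrichs' theory

Support file (everything proved). If the operator fields `A_j, B : ℝ × ℝ³ → (W →L W)` of a
first-order system `∂_t U = Σ_j A_j ∂_j U + B U` are smooth, the `A_j` are symmetric, and all
of them are constant in `{‖x⃗‖ > ρ}`, then the frozen-time family
`(t ↦ A_j(t, ·), t ↦ B(t, ·))` is a regular admissible symmetric coefficient family in the sense of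
the tree's symmetric hyperbolic theory (`Literature.Analysis.PDE.IsRegularSymmCoeffFamily`, the
hypothesis of `Literature.Analysis.PDE.exists_smooth_solution`): all spatial word derivatives are
bounded and Lipschitz in time uniformly on compact time intervals — by continuity on a compact
cylinder and constancy outside, transported from the slice lemmas
`KerrSchild.exists_bound_cwd_slice`, `KerrSchild.exists_lipschitz_slice`,
`KerrSchild.exists_lipschitz_cwd_slice` on `ℝ⁴` (Friedrichs 1954, §1; Hörmander 1997, §6.3).
Main result: `isRegularSymmCoeffFamily_of_flat`.

## References

* K. O. Friedrichs, *Symmetric hyperbolic linear differential equations*, CPAM 7 (1954), §1.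
  [Friedrichs1954]
* L. Hörmander, *Lectures on Nonlinear Hyperbolic Differential Equations*, Springer 1997, §6.3.
  [Hormander1997]
-/

noncomputable section

open Set Filter Metric
open scoped ContDiff Topology RealInnerProductSpace

namespace Literature.Geometry.Lorentzian

open Literature.Analysis.PDE KerrSchild

section Flat

variable {G : Type*} [NormedAddCommGroup G] [NormedSpace ℝ G]

/-- Transport of a field on `ℝ × ℝ³` to `ℝ⁴`. [folklore] -/
def toE4Field (F : ℝ × E3 → G) : E4 → G := fun x ↦ F (x 0, E4.spatial x)

/-- The transported field is smooth. [folklore] -/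
theorem contDiff_toE4Field {F : ℝ × E3 → G} (hF : ContDiff ℝ ∞ F) : ContDiff ℝ ∞ (toE4Field F) :=
  hF.comp E4Split.timeSpace.contDiff

omit [NormedAddCommGroup G] [NormedSpace ℝ G] in
/-- Slices of the transported field are the frozen-time fields. [folklore] -/
theorem toE4Field_ofTimeSpace (F : ℝ × E3 → G) (t : ℝ) :
    (fun y : E3 ↦ toE4Field F (E4.ofTimeSpace t y)) = fun y ↦ F (t, y) := by
  funext y
  simp [toE4Field]

omit [NormedAddCommGroup G] [NormedSpace ℝ G] in
/-- A field constant in `{‖x⃗‖ > ρ}` transports to a field constant outside the cylinder of every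
slab. [folklore] -/
theorem toE4Field_flat {F : ℝ × E3 → G} {ρ : ℝ} {c : G} (hflat : ∀ p : ℝ × E3, ρ < ‖p.2‖ → F p = c)
    (T' : ℝ) : ∀ x : E4, |x 0| < T' + 1 → ρ < ‖E4.spatial x‖ → toE4Field F x = c :=
  fun _ _ hx ↦ hflat _ hx

/-- **Uniform bounds for the spatial word derivatives** of a smooth field which is constant in
`{‖x⃗‖ > ρ}`, on compact time intervals. [cite: Hormander1997, §6.3 (6.3.15)] -/
theorem exists_bound_cwd_of_flat {F : ℝ × E3 → G} (hF : ContDiff ℝ ∞ F) {ρ : ℝ} {c : G}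
    (hflat : ∀ p : ℝ × E3, ρ < ‖p.2‖ → F p = c) (T' : ℝ) (v : List (Fin 3)) :
    ∃ M, 0 ≤ M ∧ ∀ t ∈ Icc (-T') T', ∀ y : E3, ‖cwd v (fun y : E3 ↦ F (t, y)) y‖ ≤ M := by
  obtain ⟨M, hM⟩ := exists_bound_cwd_slice (contDiff_toE4Field hF) (toE4Field_flat hflat T') v
  refine ⟨max M 0, le_max_right _ _, fun t ht y ↦ ?_⟩
  have h := hM t ht y
  rw [toE4Field_ofTimeSpace] at h
  exact h.trans (le_max_left _ _)

/-- **Lipschitz continuity in time of the spatial word derivatives** of a smooth field which is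
constant in `{‖x⃗‖ > ρ}`, uniformly in space, on compact time intervals. [cite: Friedrichs1954, §1] -/
theorem exists_lipschitz_cwd_of_flat {F : ℝ × E3 → G} (hF : ContDiff ℝ ∞ F) {ρ : ℝ} {c : G}
    (hflat : ∀ p : ℝ × E3, ρ < ‖p.2‖ → F p = c) (T' : ℝ) (v : List (Fin 3)) :
    ∃ L, 0 ≤ L ∧ ∀ s ∈ Icc (-T') T', ∀ t ∈ Icc (-T') T', ∀ y : E3,
      ‖cwd v (fun y : E3 ↦ F (t, y)) y - cwd v (fun y : E3 ↦ F (s, y)) y‖ ≤ L * |t - s| := by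
  obtain ⟨L, hL0, hL⟩ := exists_lipschitz_cwd_slice (contDiff_toE4Field hF) (toE4Field_flat hflat T') v
  refine ⟨L, hL0, fun s hs t ht y ↦ ?_⟩
  have h := hL s hs t ht y
  rwa [toE4Field_ofTimeSpace, toE4Field_ofTimeSpace] at h

end Flat

section Family

variable {W : Type*} [NormedAddCommGroup W] [InnerProductSpace ℝ W]

/-- **Symmetric smooth coefficients on `ℝ × ℝ³`, constant far out, are regular admissible
coefficients.** If `A_j, B : ℝ × ℝ³ → (W →L W)` are smooth, the `A_j` are symmetric, and all are
constant in `{‖x⃗‖ > ρ}`, then `(t ↦ A_j(t, ·), t ↦ B(t, ·))` is an `IsRegularSymmCoeffFamily`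
(Friedrichs 1954, §1: coefficients with bounded derivatives). [cite: Friedrichs1954, §1] -/
theorem isRegularSymmCoeffFamily_of_flat {A : Fin 3 → ℝ × E3 → (W →L[ℝ] W)} {B : ℝ × E3 → (W →L[ℝ] W)}
    (hA : ∀ j, ContDiff ℝ ∞ (A j)) (hB : ContDiff ℝ ∞ B)
    (hsymm : ∀ j p (u w : W), ⟪A j p u, w⟫ = ⟪u, A j p w⟫) {ρ : ℝ} {cA : Fin 3 → W →L[ℝ] W}
    {cB : W →L[ℝ] W} (hflatA : ∀ j (p : ℝ × E3), ρ < ‖p.2‖ → A j p = cA j)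
    (hflatB : ∀ p : ℝ × E3, ρ < ‖p.2‖ → B p = cB) :
    IsRegularSymmCoeffFamily (fun j t (y : E3) ↦ A j (t, y)) (fun t (y : E3) ↦ B (t, y)) := by
  have hAt : ∀ j t, ContDiff ℝ ∞ (fun y : E3 ↦ A j (t, y)) := fun j t ↦
    (hA j).comp (contDiff_prodMk_right t)
  have hBt : ∀ t, ContDiff ℝ ∞ (fun y : E3 ↦ B (t, y)) := fun t ↦ hB.comp (contDiff_prodMk_right t)
  -- uniform bounds of all word derivatives on compact time intervals
  have hbound : ∀ (T' : ℝ) (k : ℕ), ∃ M, 0 ≤ M ∧ ∀ t ∈ Icc (-T') T',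
      (∀ (j : Fin 3) (v : List (Fin 3)), v.length ≤ k + 1 → ∀ y,
        ‖cwd v (fun y : E3 ↦ A j (t, y)) y‖ ≤ M) ∧
      (∀ v : List (Fin 3), v.length ≤ k → ∀ y, ‖cwd v (fun y : E3 ↦ B (t, y)) y‖ ≤ M) := by
    intro T' k
    have hA' : ∀ (j : Fin 3) (v : List (Fin 3)), ∃ M, 0 ≤ M ∧ ∀ t ∈ Icc (-T') T', ∀ y,
        ‖cwd v (fun y : E3 ↦ A j (t, y)) y‖ ≤ M := fun j v ↦
      exists_bound_cwd_of_flat (hA j) (hflatA j) T' v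
    have hB' : ∀ v : List (Fin 3), ∃ M, 0 ≤ M ∧ ∀ t ∈ Icc (-T') T', ∀ y,
        ‖cwd v (fun y : E3 ↦ B (t, y)) y‖ ≤ M := fun v ↦ exists_bound_cwd_of_flat hB hflatB T' v
    choose MA hMA0 hMA using hA'
    choose MB hMB0 hMB using hB'
    refine ⟨∑ v ∈ wordsLE (Fin 3) (k + 1), ((∑ j : Fin 3, MA j v) + MB v), ?_, fun t ht ↦ ⟨?_, ?_⟩⟩
    · exact Finset.sum_nonneg fun v _ ↦ add_nonneg (Finset.sum_nonneg fun j _ ↦ hMA0 j v) (hMB0 v)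
    · intro j v hv y
      have hvm : v ∈ wordsLE (Fin 3) (k + 1) := mem_wordsLE.2 hv
      calc ‖cwd v (fun y : E3 ↦ A j (t, y)) y‖ ≤ MA j v := hMA j v t ht y
        _ ≤ (∑ j' : Fin 3, MA j' v) + MB v :=
            (Finset.single_le_sum (f := fun j' ↦ MA j' v) (fun j' _ ↦ hMA0 j' v)
              (Finset.mem_univ j)).trans (le_add_of_nonneg_right (hMB0 v))
        _ ≤ _ := Finset.single_le_sum (f := fun v ↦ (∑ j' : Fin 3, MA j' v) + MB v)
            (fun v _ ↦ add_nonneg (Finset.sum_nonneg fun j _ ↦ hMA0 j v) (hMB0 v)) hvm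
    · intro v hv y
      have hvm : v ∈ wordsLE (Fin 3) (k + 1) := mem_wordsLE.2 (Nat.le_succ_of_le hv)
      calc ‖cwd v (fun y : E3 ↦ B (t, y)) y‖ ≤ MB v := hMB v t ht y
        _ ≤ (∑ j' : Fin 3, MA j' v) + MB v :=
            le_add_of_nonneg_left (Finset.sum_nonneg fun j _ ↦ hMA0 j v)
        _ ≤ _ := Finset.single_le_sum (f := fun v ↦ (∑ j' : Fin 3, MA j' v) + MB v)
            (fun v _ ↦ add_nonneg (Finset.sum_nonneg fun j _ ↦ hMA0 j v) (hMB0 v)) hvm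
  -- Lipschitz bounds of all word derivatives on compact time intervals
  have hlip : ∀ (T' : ℝ) (k : ℕ), ∃ L, 0 ≤ L ∧ ∀ s ∈ Icc (-T') T', ∀ t ∈ Icc (-T') T', ∀ y : E3,
      (∀ (j : Fin 3) (v : List (Fin 3)), v.length ≤ k →
        ‖cwd v (fun y : E3 ↦ A j (t, y)) y - cwd v (fun y : E3 ↦ A j (s, y)) y‖ ≤ L * |t - s|) ∧
      (∀ v : List (Fin 3), v.length ≤ k →
        ‖cwd v (fun y : E3 ↦ B (t, y)) y - cwd v (fun y : E3 ↦ B (s, y)) y‖ ≤ L * |t - s|) := by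
    intro T' k
    have hA' : ∀ (j : Fin 3) (v : List (Fin 3)), ∃ L, 0 ≤ L ∧ ∀ s ∈ Icc (-T') T',
        ∀ t ∈ Icc (-T') T', ∀ y : E3,
        ‖cwd v (fun y : E3 ↦ A j (t, y)) y - cwd v (fun y : E3 ↦ A j (s, y)) y‖ ≤ L * |t - s| :=
      fun j v ↦ exists_lipschitz_cwd_of_flat (hA j) (hflatA j) T' v
    have hB' : ∀ v : List (Fin 3), ∃ L, 0 ≤ L ∧ ∀ s ∈ Icc (-T') T', ∀ t ∈ Icc (-T') T', ∀ y : E3,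
        ‖cwd v (fun y : E3 ↦ B (t, y)) y - cwd v (fun y : E3 ↦ B (s, y)) y‖ ≤ L * |t - s| :=
      fun v ↦ exists_lipschitz_cwd_of_flat hB hflatB T' v
    choose LA hLA0 hLA using hA'
    choose LB hLB0 hLB using hB'
    refine ⟨∑ v ∈ wordsLE (Fin 3) k, ((∑ j : Fin 3, LA j v) + LB v), ?_, fun s hs t ht y ↦ ⟨?_, ?_⟩⟩
    · exact Finset.sum_nonneg fun v _ ↦ add_nonneg (Finset.sum_nonneg fun j _ ↦ hLA0 j v) (hLB0 v)
    · intro j v hv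
      have hvm : v ∈ wordsLE (Fin 3) k := mem_wordsLE.2 hv
      refine (hLA j v s hs t ht y).trans (mul_le_mul_of_nonneg_right ?_ (abs_nonneg _))
      calc LA j v ≤ (∑ j' : Fin 3, LA j' v) + LB v :=
            (Finset.single_le_sum (f := fun j' ↦ LA j' v) (fun j' _ ↦ hLA0 j' v)
              (Finset.mem_univ j)).trans (le_add_of_nonneg_right (hLB0 v))
        _ ≤ _ := Finset.single_le_sum (f := fun v ↦ (∑ j' : Fin 3, LA j' v) + LB v)
            (fun v _ ↦ add_nonneg (Finset.sum_nonneg fun j _ ↦ hLA0 j v) (hLB0 v)) hvm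
    · intro v hv
      have hvm : v ∈ wordsLE (Fin 3) k := mem_wordsLE.2 hv
      refine (hLB v s hs t ht y).trans (mul_le_mul_of_nonneg_right ?_ (abs_nonneg _))
      calc LB v ≤ (∑ j' : Fin 3, LA j' v) + LB v :=
            le_add_of_nonneg_left (Finset.sum_nonneg fun j _ ↦ hLA0 j v)
        _ ≤ _ := Finset.single_le_sum (f := fun v ↦ (∑ j' : Fin 3, LA j' v) + LB v)
            (fun v _ ↦ add_nonneg (Finset.sum_nonneg fun j _ ↦ hLA0 j v) (hLB0 v)) hvm
  refine
    { coeff := fun T' k ↦ ?_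
      lip := fun T' ↦ ?_
      jointA := fun j ↦ hA j
      jointB := hB
      lipk := hlip }
  · obtain ⟨M, _, hM⟩ := hbound T' k
    exact ⟨M, fun t ht ↦ ⟨fun j ↦ hAt j t, hBt t, fun j y u w ↦ hsymm j _ u w,
      fun j v hv y ↦ (hM t ht).1 j v hv y, fun v hv y ↦ (hM t ht).2 v hv y⟩⟩
  · obtain ⟨L, hL0, hL⟩ := hlip T' 0
    refine ⟨L, hL0, fun s hs t ht y ↦ ⟨fun j ↦ ?_, ?_⟩⟩
    · simpa using (hL s hs t ht y).1 j [] le_rfl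
    · simpa using (hL s hs t ht y).2 [] le_rfl

end Family

end Literature.Geometry.Lorentzian

end
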